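import Summits.AtomisticToContinuum.BoseEinsteinCondensation.Theorems.InfraredMinimumUncertainty.Negative.DensityWavePairings

/-!
# Negative lemmas for crux `InfraredMinimumUncertainty` (stmt-AtomisticToContinuum-11784) — XIII:
# the free density wave of slack `δ` against the four ladder rungs

Supports (does not close) stmt-AtomisticToContinuum-11784.  Importable form of §H (part 5 of 6) of the
cdisprove seat's standing file `Cruxes/InfraredMinimumUncertainty/Disproof.lean` (generation 2).

* `fisherTestV_affineField_waveState_ge`: at the centred affine field `φ_{1/N,μ_N}`,
  **`J^V_{e₀}(φ) ≥ (8/9)/N`** on the density wave (`ε² ≤ 1/16`): pairing `2λ(1+ε²)/(1+2ε²)` from the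
  `Z`/`Z̄` pairings and `∫WΨ̄ = 0`, minus `λ² Var Re Z ≤ λ² N`;
* **`ladder_free_near_minimiser_witness`**: free gas, any `ρ > 0`, `N`, slack `δ > 0`: the density wave with
  `ε² = min(1/16, δL²/(16π²N))` is a positive real admissible state of energy `≤ δ` with, at `m = e₀` and
  `T := min(N/16, δL²/(16π²))`: `N ν ≥ (7/8)T`, `S ≥ 3T`, `N‖k‖⁴ ≤ m₂ ≤ 2N‖k‖⁴`, `J^V(φ) ≤ 8/N` for EVERY
  continuous `φ` (AM–GM rung), `J^V(φ_{1/N,μ_N}) ≥ (8/9)/N`.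
-/

noncomputable section

open MeasureTheory Filter Set
open scoped ENNReal NNReal Topology ComplexConjugate BigOperators

namespace Summit.AtomisticToContinuum.BoseEinsteinCondensation.Theorems.InfraredMinimumUncertainty.Negative

open Literature.MathematicalPhysics.QuantumManyBody.BoseGas
open Summit.AtomisticToContinuum.BoseEinsteinCondensation.Theses.BECConjugateDomination
open Summit.AtomisticToContinuum.BoseEinsteinCondensation.Cruxes.InfraredMinimumUncertainty.FisherGaussianDensityMode
open Summit.AtomisticToContinuum.BoseEinsteinCondensation.Theorems.GaussianDominationCan.Negative
  (prodFun contDiff_prodFun fderiv_prodFun integral_cellN_prod)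
open Summit.AtomisticToContinuum.BoseEinsteinCondensation.Theorems.StaticResponseBound.Negative
  (arg re_cellWave integral_norm_sq_eq_one phiMode argCLM argCLM_apply integral_cell_trig_combo
    phiMode_sq integral_cell_phiMode_sq arg_intSMul isRepulsiveFiniteRange_zero)
open Summit.AtomisticToContinuum.BoseEinsteinCondensation.Theorems.CorrectorClosure.Negative
  (e0 e0_ne_zero sideLength_succ_pos)

/-! ### The witness: the free density wave of slack `δ` against the four rungs -/

section Witness

variable {n : ℕ}

/-- `N · min(1/16, δL²/(16π²N)) = min(N/16, δL²/(16π²))`. [folklore] -/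
theorem succ_mul_min_eq (n : ℕ) (δ L : ℝ) :
    ((n : ℝ) + 1) * min (1 / 16) (δ * L ^ 2 / (16 * Real.pi ^ 2 * ((n : ℝ) + 1))) =
      min (((n : ℝ) + 1) / 16) (δ * L ^ 2 / (16 * Real.pi ^ 2)) := by
  have hN : (0 : ℝ) < (n : ℝ) + 1 := by positivity
  rw [mul_min_of_nonneg _ _ hN.le]
  congr 1
  · ring
  · field_simp

/-- **The lifted Fisher functional of the density wave at the centred affine field**:
`J^V(φ_{1/N,μ_N}) ≥ (8/9)/N` for `ε² ≤ 1/16` (pairing `2λ(1 − ε²/(1+2ε²))` from the `Z`/`Z̄`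
pairings and `∫WΨ̄ = 0`, minus `λ² Var(Re Z) ≤ λ² N`, at `λ = 1/N`). [folklore] -/
theorem fisherTestV_affineField_waveState_ge {L : ℝ} (hL : 0 < L) {ε : ℝ} (hε : |ε| < 1 / 2)
    (hε16 : ε ^ 2 ≤ 1 / 16) :
    (8 / 9) / ((n : ℝ) + 1) ≤
      fisherTestV n L (waveState n hL ε) e0 (affineField ((n : ℝ) + 1)⁻¹ (waveMean n ε)) := by
  unfold fisherTestV
  simp only [waveState_ψ]
  have hN : (0 : ℝ) < (n : ℝ) + 1 := by positivity
  set lam : ℝ := ((n : ℝ) + 1)⁻¹ with hlam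
  set μ : ℝ := waveMean n ε with hμ
  set K : ℝ := (2 * Real.pi / L) ^ 2 with hKdef
  have hK0 : 0 < K := by positivity
  have hKw : ‖waveVec L e0‖ ^ 2 = K := norm_waveVec_e0_sq L
  rw [hKw]
  set s' : ℝ := ε ^ 2 / (1 + 2 * ε ^ 2) with hs'
  have hs'le : s' ≤ 1 / 18 := by
    rw [hs', div_le_iff₀ (by positivity)]; linarith
  -- continuity / integrability
  have hZ : Continuous fun X : Config (n + 1) => densityMode (n + 1) L e0 X := by
    unfold densityMode; fun_prop
  have hW : Continuous fun X : Config (n + 1) => commutatorAmp (n + 1) L (waveFun n L ε) e0 X := by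
    have h := continuous_commutatorAmp (waveState n hL ε) e0
    simpa only [waveState_ψ] using h
  have hψ : Continuous (waveFun n L ε) := (contDiff_prodFun fun _ => contDiff_waveFactorC L ε).continuous
  have hWΨ : Continuous fun X : Config (n + 1) =>
      commutatorAmp (n + 1) L (waveFun n L ε) e0 X * conj (waveFun n L ε X) :=
    hW.mul (Complex.continuous_conj.comp hψ)
  have i1 : Integrable (fun X : Config (n + 1) => densityMode (n + 1) L e0 X *
      commutatorAmp (n + 1) L (waveFun n L ε) e0 X * conj (waveFun n L ε X))
      (volume.restrict (cellN (n + 1) L)) := by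
    have : Continuous fun X : Config (n + 1) => densityMode (n + 1) L e0 X *
        commutatorAmp (n + 1) L (waveFun n L ε) e0 X * conj (waveFun n L ε X) := by
      simp_rw [mul_assoc]; exact hZ.mul hWΨ
    exact integrableOn_cellN this L
  have i2 : Integrable (fun X : Config (n + 1) => conj (densityMode (n + 1) L e0 X) *
      commutatorAmp (n + 1) L (waveFun n L ε) e0 X * conj (waveFun n L ε X))
      (volume.restrict (cellN (n + 1) L)) := by
    have : Continuous fun X : Config (n + 1) => conj (densityMode (n + 1) L e0 X) *
        commutatorAmp (n + 1) L (waveFun n L ε) e0 X * conj (waveFun n L ε X) := by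
      simp_rw [mul_assoc]; exact (Complex.continuous_conj.comp hZ).mul hWΨ
    exact integrableOn_cellN this L
  have i3 : Integrable (fun X : Config (n + 1) =>
      commutatorAmp (n + 1) L (waveFun n L ε) e0 X * conj (waveFun n L ε X))
      (volume.restrict (cellN (n + 1) L)) := integrableOn_cellN hWΨ L
  have hφc : Continuous (affineField lam μ) := (contDiff_affineField lam μ).continuous
  have hint : Integrable (fun X : Config (n + 1) =>
      conj (affineField lam μ (densityMode (n + 1) L e0 X)) *
        commutatorAmp (n + 1) L (waveFun n L ε) e0 X * conj (waveFun n L ε X))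
      (volume.restrict (cellN (n + 1) L)) := by
    have : Continuous fun X : Config (n + 1) => conj (affineField lam μ (densityMode (n + 1) L e0 X)) *
        commutatorAmp (n + 1) L (waveFun n L ε) e0 X * conj (waveFun n L ε X) := by
      simp_rw [mul_assoc]; exact (Complex.continuous_conj.comp (hφc.comp hZ)).mul hWΨ
    exact integrableOn_cellN this L
  -- pointwise decomposition of the complex pairing integrand
  have hpt : ∀ X : Config (n + 1),
      conj (affineField lam μ (densityMode (n + 1) L e0 X)) *
        commutatorAmp (n + 1) L (waveFun n L ε) e0 X * conj (waveFun n L ε X) =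
      (-(lam : ℂ) / 2) * (densityMode (n + 1) L e0 X *
          commutatorAmp (n + 1) L (waveFun n L ε) e0 X * conj (waveFun n L ε X))
      + (-(lam : ℂ) / 2) * (conj (densityMode (n + 1) L e0 X) *
          commutatorAmp (n + 1) L (waveFun n L ε) e0 X * conj (waveFun n L ε X))
      + ((lam * μ : ℝ) : ℂ) * (commutatorAmp (n + 1) L (waveFun n L ε) e0 X * conj (waveFun n L ε X)) := by
    intro X
    have hre : (((densityMode (n + 1) L e0 X).re : ℝ) : ℂ) =
        (densityMode (n + 1) L e0 X + conj (densityMode (n + 1) L e0 X)) / 2 := by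
      rw [Complex.add_conj]; push_cast; ring
    rw [affineField, Complex.conj_ofReal]
    push_cast
    rw [hre]
    ring
  have I1 := integral_densityMode_mul_commutatorAmp_waveFun (n := n) hL ε
  have I2 := integral_conj_densityMode_mul_commutatorAmp_waveFun (n := n) hL ε
  have I3 := integral_commutatorAmp_mul_conj_waveFun (n := n) hL ε
  set r : ℝ := (-lam / 2) * K * ((n : ℝ) + 1) * (1 - s') with hr
  have hcplx : ∫ X in cellN (n + 1) L, conj (affineField lam μ (densityMode (n + 1) L e0 X)) *
      commutatorAmp (n + 1) L (waveFun n L ε) e0 X * conj (waveFun n L ε X) = (r : ℂ) := by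
    simp_rw [hpt]
    have j1 : Integrable (fun X : Config (n + 1) => (-(lam : ℂ) / 2) * (densityMode (n + 1) L e0 X *
        commutatorAmp (n + 1) L (waveFun n L ε) e0 X * conj (waveFun n L ε X)))
        (volume.restrict (cellN (n + 1) L)) := i1.const_mul _
    have j2 : Integrable (fun X : Config (n + 1) => (-(lam : ℂ) / 2) * (conj (densityMode (n + 1) L e0 X) *
        commutatorAmp (n + 1) L (waveFun n L ε) e0 X * conj (waveFun n L ε X)))
        (volume.restrict (cellN (n + 1) L)) := i2.const_mul _
    have j3 : Integrable (fun X : Config (n + 1) => ((lam * μ : ℝ) : ℂ) *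
        (commutatorAmp (n + 1) L (waveFun n L ε) e0 X * conj (waveFun n L ε X)))
        (volume.restrict (cellN (n + 1) L)) := i3.const_mul _
    have j12 : Integrable (fun X : Config (n + 1) => (-(lam : ℂ) / 2) * (densityMode (n + 1) L e0 X *
        commutatorAmp (n + 1) L (waveFun n L ε) e0 X * conj (waveFun n L ε X))
        + (-(lam : ℂ) / 2) * (conj (densityMode (n + 1) L e0 X) *
        commutatorAmp (n + 1) L (waveFun n L ε) e0 X * conj (waveFun n L ε X)))
        (volume.restrict (cellN (n + 1) L)) := j1.add j2
    rw [integral_add j12 j3, integral_add j1 j2, integral_const_mul, integral_const_mul,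
      integral_const_mul, I1, I2, I3, hr, hs', hKdef]
    push_cast
    ring
  have hreal : ∫ X in cellN (n + 1) L, (conj (affineField lam μ (densityMode (n + 1) L e0 X)) *
      commutatorAmp (n + 1) L (waveFun n L ε) e0 X * conj (waveFun n L ε X)).re = r := by
    have h := integral_re hint
    simp only [RCLike.re_to_complex] at h
    rw [h, hcplx, Complex.ofReal_re]
  -- the quadratic term
  have h2 : ∀ X : Config (n + 1), ‖affineField lam μ (densityMode (n + 1) L e0 X)‖ ^ 2 *
      ‖waveFun n L ε X‖ ^ 2 =
      lam ^ 2 * (((densityMode (n + 1) L e0 X).re - μ) ^ 2 * ‖waveFun n L ε X‖ ^ 2) := by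
    intro X
    rw [affineField, Complex.norm_real, Real.norm_eq_abs, sq_abs]
    ring
  have hV := variance_re_densityMode_waveState_le (n := n) hL hε
  rw [hreal]
  simp_rw [h2]
  rw [integral_const_mul]
  have hV0 : 0 ≤ ∫ X in cellN (n + 1) L, ((densityMode (n + 1) L e0 X).re - waveMean n ε) ^ 2 *
      ‖waveFun n L ε X‖ ^ 2 := integral_nonneg fun X => by positivity
  -- arithmetic: J = 2 lam (1 - s') - lam² V ≥ (1 - 2 s')/N ≥ (8/9)/N
  have hfirst : -(4 / (((n : ℝ) + 1) * K)) * r = 2 * lam * (1 - s') := by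
    rw [hr]; field_simp; ring
  rw [hfirst, hlam]
  have hVle : ((n : ℝ) + 1)⁻¹ ^ 2 * ∫ X in cellN (n + 1) L,
      ((densityMode (n + 1) L e0 X).re - μ) ^ 2 * ‖waveFun n L ε X‖ ^ 2 ≤ ((n : ℝ) + 1)⁻¹ := by
    calc ((n : ℝ) + 1)⁻¹ ^ 2 * ∫ X in cellN (n + 1) L,
          ((densityMode (n + 1) L e0 X).re - μ) ^ 2 * ‖waveFun n L ε X‖ ^ 2
        ≤ ((n : ℝ) + 1)⁻¹ ^ 2 * ((n : ℝ) + 1) := mul_le_mul_of_nonneg_left hV (by positivity)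
      _ = ((n : ℝ) + 1)⁻¹ := by field_simp
  have hs'0 : 0 ≤ s' := by positivity
  rw [div_eq_mul_inv, show (8 / 9 : ℝ) * ((n : ℝ) + 1)⁻¹ =
    2 * ((n : ℝ) + 1)⁻¹ * (1 - 1 / 18) - ((n : ℝ) + 1)⁻¹ by ring]
  have hinv : 0 ≤ ((n : ℝ) + 1)⁻¹ := by positivity
  nlinarith [mul_le_mul_of_nonneg_left hs'le hinv, hVle]

/-- **THE LADDER WITNESS.**  Free gas, any `ρ > 0`, any `N = n+1`, any slack `δ > 0`: the density
wave of amplitude `ε² = min(1/16, δL²/(16π²N))` (`L = (N/ρ)^{1/3}`) is a positive real admissible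
state with `periodicEnergy 0 Ψ ≤ δ` and, at the mode `e₀` (`‖k‖² = (2π/L)²`,
`T := min(N/16, δL²/(16π²))`):  `N ν ≥ (7/8) T`, `S ≥ 3 T`, `N‖k‖⁴ ≤ m₂ ≤ 2N‖k‖⁴`,
`J^V(φ) ≤ 8/N` for every continuous `φ`, and `J^V(φ_{1/N,μ_N}) ≥ (8/9)/N`. [folklore] -/
theorem ladder_free_near_minimiser_witness {ρ : ℝ} (hρ : 0 < ρ) (n : ℕ) {δ : ℝ} (hδ : 0 < δ) :
    ∃ Ψ : PeriodicTrialState (n + 1) (sideLength ρ (n + 1)),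
      periodicEnergy 0 Ψ ≤ ENNReal.ofReal δ ∧ (∀ X, Ψ.ψ X = (‖Ψ.ψ X‖ : ℂ)) ∧ (∀ X, Ψ.ψ X ≠ 0) ∧
      (7 / 8) * min (((n : ℝ) + 1) / 16) (δ * sideLength ρ (n + 1) ^ 2 / (16 * Real.pi ^ 2)) ≤
          ((n : ℝ) + 1) * levyWeight n (sideLength ρ (n + 1)) Ψ e0 ∧
      3 * min (((n : ℝ) + 1) / 16) (δ * sideLength ρ (n + 1) ^ 2 / (16 * Real.pi ^ 2)) ≤
          structureFactor n (sideLength ρ (n + 1)) Ψ e0 ∧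
      ((n : ℝ) + 1) * ‖waveVec (sideLength ρ (n + 1)) e0‖ ^ 4 ≤
          secondMoment (n + 1) (sideLength ρ (n + 1)) Ψ.ψ e0 ∧
      secondMoment (n + 1) (sideLength ρ (n + 1)) Ψ.ψ e0 ≤
          2 * ((n : ℝ) + 1) * ‖waveVec (sideLength ρ (n + 1)) e0‖ ^ 4 ∧
      (∀ φ : ℂ → ℂ, Continuous φ →
          fisherTestV n (sideLength ρ (n + 1)) Ψ e0 φ ≤ 8 / ((n : ℝ) + 1)) ∧
      (∃ φ : ℂ → ℂ, Continuous φ ∧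
          (8 / 9) / ((n : ℝ) + 1) ≤ fisherTestV n (sideLength ρ (n + 1)) Ψ e0 φ) := by
  set L := sideLength ρ (n + 1) with hLdef
  have hL : 0 < L := sideLength_succ_pos hρ n
  have hN : (0 : ℝ) < (n : ℝ) + 1 := by positivity
  set s : ℝ := min (1 / 16) (δ * L ^ 2 / (16 * Real.pi ^ 2 * ((n : ℝ) + 1))) with hs
  have hs0 : 0 < s := lt_min (by norm_num) (by positivity)
  have hs16 : s ≤ 1 / 16 := min_le_left _ _
  set ε : ℝ := Real.sqrt s with hεdef
  have hε2 : ε ^ 2 = s := Real.sq_sqrt hs0.le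
  have hεpos : 0 < ε := Real.sqrt_pos.mpr hs0
  have hε : |ε| < 1 / 2 := by
    rw [abs_of_pos hεpos]
    have : ε ≤ Real.sqrt (1 / 16) := Real.sqrt_le_sqrt hs16
    rw [show (1 / 16 : ℝ) = (1 / 4) ^ 2 by norm_num, Real.sqrt_sq (by norm_num)] at this
    linarith
  have hT : ((n : ℝ) + 1) * s = min (((n : ℝ) + 1) / 16) (δ * L ^ 2 / (16 * Real.pi ^ 2)) :=
    succ_mul_min_eq n δ L
  have hK : ‖waveVec L e0‖ ^ 4 = ((2 * Real.pi / L) ^ 2) ^ 2 := by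
    rw [show (4 : ℕ) = 2 * 2 from rfl, pow_mul, norm_waveVec_e0_sq]
  have hK0 : 0 < (2 * Real.pi / L) ^ 2 := by positivity
  -- the second moment in closed form
  have hm2 : secondMoment (n + 1) L (waveFun n L ε) e0 =
      ((n : ℝ) + 1) * ((2 * Real.pi / L) ^ 2) ^ 2 * ((1 + 10 * s) / (1 + 2 * s)) := by
    rw [secondMoment_waveFun hL ε, hε2]
  have hfrac1 : 1 ≤ (1 + 10 * s) / (1 + 2 * s) := by
    rw [le_div_iff₀ (by positivity)]; linarith
  have hfrac2 : (1 + 10 * s) / (1 + 2 * s) ≤ 2 := by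
    rw [div_le_iff₀ (by positivity)]; linarith
  refine ⟨waveState n hL ε, ?_, waveFun_eq_norm hL hε, waveFun_ne_zero hL hε, ?_, ?_, ?_, ?_, ?_, ?_⟩
  · -- energy
    refine (periodicEnergy_waveState_le hL).trans (ENNReal.ofReal_le_ofReal ?_)
    rw [hε2, div_le_iff₀ (by positivity : (0 : ℝ) < L ^ 2)]
    have h2 : s ≤ δ * L ^ 2 / (16 * Real.pi ^ 2 * ((n : ℝ) + 1)) := min_le_right _ _
    rw [le_div_iff₀ (by positivity)] at h2
    linarith
  · -- Lévy weight
    have hν := levyWeight_waveState_ge (n := n) hL hε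
    rw [← hT]
    have h78 : (7 / 8) * s ≤ ε ^ 2 * (1 - 2 * ε ^ 2) := by rw [hε2]; nlinarith
    calc (7 / 8) * (((n : ℝ) + 1) * s) = ((n : ℝ) + 1) * ((7 / 8) * s) := by ring
      _ ≤ ((n : ℝ) + 1) * (ε ^ 2 * (1 - 2 * ε ^ 2)) := mul_le_mul_of_nonneg_left h78 hN.le
      _ ≤ ((n : ℝ) + 1) * levyWeight n L (waveState n hL ε) e0 := mul_le_mul_of_nonneg_left hν hN.le
  · -- structure factor
    have hS := structureFactor_waveState_ge (n := n) hL hε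
    rw [← hT]
    have h3 : 3 * s ≤ (2 * ε / (1 + 2 * ε ^ 2)) ^ 2 := by
      rw [div_pow, le_div_iff₀ (by positivity), mul_pow, hε2,
        show ((2 : ℝ) ^ 2) = 4 by norm_num]
      nlinarith [sq_nonneg s]
    calc 3 * (((n : ℝ) + 1) * s) = ((n : ℝ) + 1) * (3 * s) := by ring
      _ ≤ ((n : ℝ) + 1) * (2 * ε / (1 + 2 * ε ^ 2)) ^ 2 := mul_le_mul_of_nonneg_left h3 hN.le
      _ ≤ structureFactor n L (waveState n hL ε) e0 := hS
  · -- m₂ lower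
    show ((n : ℝ) + 1) * ‖waveVec L e0‖ ^ 4 ≤ secondMoment (n + 1) L (waveFun n L ε) e0
    rw [hm2, hK]
    have : 0 ≤ ((n : ℝ) + 1) * ((2 * Real.pi / L) ^ 2) ^ 2 := by positivity
    nlinarith
  · -- m₂ upper
    show secondMoment (n + 1) L (waveFun n L ε) e0 ≤ 2 * ((n : ℝ) + 1) * ‖waveVec L e0‖ ^ 4
    rw [hm2, hK]
    have : 0 ≤ ((n : ℝ) + 1) * ((2 * Real.pi / L) ^ 2) ^ 2 := by positivity
    nlinarith
  · -- AM–GM rung for every continuous field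
    intro φ hφ
    have h := fisherTestV_le_secondMoment hL (waveState n hL ε) e0_ne_zero hφ
    refine h.trans ?_
    show 4 * secondMoment (n + 1) L (waveFun n L ε) e0 / (((n : ℝ) + 1) ^ 2 * ‖waveVec L e0‖ ^ 4) ≤
      8 / ((n : ℝ) + 1)
    rw [hm2, hK, div_le_div_iff₀ (by positivity) hN]
    have : 0 ≤ ((n : ℝ) + 1) ^ 2 * ((2 * Real.pi / L) ^ 2) ^ 2 := by positivity
    nlinarith
  · -- the centred affine field
    exact ⟨affineField ((n : ℝ) + 1)⁻¹ (waveMean n ε), (contDiff_affineField _ _).continuous,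
      fisherTestV_affineField_waveState_ge hL hε (by rw [hε2]; exact hs16)⟩

end Witness

end Summit.AtomisticToContinuum.BoseEinsteinCondensation.Theorems.InfraredMinimumUncertainty.Negative

end
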